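import Summits.CriticalPhenomena.PercolationContinuityZ3.Theorems.PercNearOneGluingNoHeavyRsw3AnnulusCriticalPointIff
import Summits.CriticalPhenomena.PercolationContinuityZ3.Theorems.PercNearOneGluingNoHeavyRsw3HardCrossingRateCriterion
import Summits.CriticalPhenomena.PercolationContinuityZ3.Theorems.PercNearOneGluingNoHeavyRsw3OneArmHarrisMargin
import Summits.CriticalPhenomena.PercolationContinuityZ3.Theorems.PercNearOneGluingNoHeavyRsw3CrossingBridges
import Summits.CriticalPhenomena.PercolationContinuityZ3.Theorems.SoloInformedSlabBoxFace
import HarnessLib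

/-!
# RSW3 lane (P2, gen 9): KESTEN'S SPONGE CRITERION FOR `ℤ³` — `p < p_c(ℤ³) ⟺ ∃ n, P_p(boxCross (easyShape 3 (2n)) 0) < 1/5184`;
# hence the short-way sponge crossing is `≥ 1/5184` at every `p ≥ p_c(ℤ³)` and every scale (explicit constant)

builds on p205010 (kernel theorem, internal audit signed; external expert review pending) — NOT used in this file: everything
here is sharpness-side (finite-size criterion + Menshikov/Aizenman–Barsky exponential decay) and holds unconditionally.

Cell `prim-rsw3`, prover seat `prim-rsw3-p2` (gen 9), memo `run/shared/lean/prim/rsw3/P2-RSWLITE.md` §15b.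
Support file (`--supports stmt-CriticalPhenomena-4575`); no definitions, no named facts, no sorries.

Kesten (1982, §3.3 (3.65), Thm. 5.1, Cor. 5.1) defines the sponge critical probability `p_S` through the SHORT-way crossings of
the blocks `(3N, …, 3N, N, 3N, …, 3N)` and proves `p_T = p_S`: if at one scale all `2d` short-way sponge crossing probabilities are
below a universal `κ = κ(d)`, the cluster size has an exponential tail.  This file is the `ℤ³` bond version in the lane's vocabulary
(`Crossing.boxCross (easyShape 3 m) 0` = the block `{0..m} × {0..3m}²` crossed the thin way), with the explicit threshold `1/5184`:

* `real_boxCrossing_three_mul_le_mul_thinCrossing` (every `p`, every `d`): `u_p(n,3n) ≤ 2d · P_p(thinCrossing n 0 1)` — an annulus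
  crossing `Λ(n) ↔ ∂ⁱⁿΛ(3n)` crosses one of the `2d` slab-boxes of `Λ(3n)` the thin way (`SurfaceTension.boxCrossing_subset_iUnion_thinCrossing`,
  union bound, `SurfaceTension.real_thinCrossing_eq`).
* `real_thinCrossing_le_real_boxCross_easyShape` (`d = 3`, every `p`): the slab-box `[n,3n] × [-3n,3n]²` with its faces is a translate
  of `{0..2n} × {0..6n}²`: `P_p(thinCrossing n 0 1) ≤ P_p(boxCross (easyShape 3 (2n)) 0)` (`Rsw3.real_linked_le_real_boxCross`).
* `lt_criticalProb_of_real_boxCross_easyShape_three_lt` — **`P_p(boxCross (easyShape 3 (2n)) 0) < 1/5184 ⇒ p < p_c(ℤ³)`** (`n ≥ 1`):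
  `u_p(n,3n) ≤ 6σ < 1/864`, i.e. `2·3·12²·u_p(n,3n) < 1`, the lane's annulus criterion at aspect `3`
  (`Rsw3.lt_criticalProb_iff_exists_real_boxCrossing_lt`, gen 2).
* `le_real_boxCross_easyShape_three_of_criticalProb_le` — **`1/5184 ≤ P_p(boxCross (easyShape 3 (2n)) 0)` for all `p ≥ p_c(ℤ³)`,
  `n ≥ 1`** (Kesten's `σ ≥ κ` on `[p_S, 1]`; the constant of the tree's `Rsw3.easyCrossingLowerBound_three` was `≈ 6·10⁻¹¹`);
  `le_real_boxCross_easyShape_three_criticalProbI` (the `p_c` instance).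
* `tendsto_real_boxCross_easyShape_three_of_lt_criticalProb` — below `p_c`, `P_p(boxCross (easyShape 3 m) 0) → 0`
  (`≤ (3m+1)² π_p(m) ≤ 96 m² u_p(1,m) → 0`: `Rsw3.real_boxCross_tube_le_sq_mul_oneArmProb`, `Rsw3.tendsto_criterion_of_lt_criticalProb`).
* `lt_criticalProb_iff_exists_real_boxCross_easyShape_three_lt` — **`p < p_c(ℤ³) ⟺ ∃ n ≥ 1, P_p(boxCross (easyShape 3 (2n)) 0) < 1/5184`**:
  `p_S = p_T = p_c` for bond percolation on `ℤ³` at even thicknesses, kernel-checked.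

HONEST PLACEMENT: a reproduction of Kesten's Thm. 5.1 / Cor. 5.1 mechanism for `ℤ³` with the lane's annulus decoupling in place of
Kesten's connected-sponge counting; elementary given the tree.  The value is the VOCABULARY (sponge blocks, the shape in which the
census and LANE 1 read crossing data) and the explicit, scale-free constant `1/5184` on `[p_c, 1]`.

References: H. Kesten, *Percolation Theory for Mathematicians* (1982), §3.3 (3.28)–(3.32), (3.65), Thm. 5.1, Cor. 5.1, (5.13)
[Kesten1982]; J. M. Hammersley, Ann. Math. Statist. 28 (1957) 790–795 (finite-size criterion); G. Grimmett, *Percolation* (1999),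
§5.2 (Menshikov / Aizenman–Barsky) [GrimmettPercolation1999]. [folklore]
-/
noncomputable section

namespace Summit.CriticalPhenomena.PercolationContinuityZ3.Theorems

open MeasureTheory ProbabilityTheory Filter Topology
open Literature.Probability.Percolation Literature.Probability.LatticeModels

namespace Rsw3

open SurfaceTension Crossing

variable {d : ℕ}

/-- **Union bound over the `2d` slab-boxes** (every `p`, every `d ≥ 1`, `n ≥ 1`):
`u_p(n, 3n) = P_p(Λ(n) ↔ ∂ⁱⁿΛ(3n) in Λ(3n)) ≤ 2d · P_p(thinCrossing n 0 1)` — an annulus crossing at aspect `3` crosses one of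
the `2d` slab-boxes `S_{i,ε}(n)` in its thin direction (`SurfaceTension.boxCrossing_subset_iUnion_thinCrossing`), and the slab-boxes
are alike (`SurfaceTension.real_thinCrossing_eq`). [cite: Kesten1982, Thm. 5.1 (proof, sponge crossings)] -/
theorem real_boxCrossing_three_mul_le_mul_thinCrossing [NeZero d] (p : unitInterval) {n : ℕ} (hn : 1 ≤ n) :
    (bondPercolation (zdGraph d) p).real (boxCrossing d n (3 * n)) ≤
      2 * d * (bondPercolation (zdGraph d) p).real (thinCrossing n (0 : Fin d) 1) := by
  classical
  set μ := bondPercolation (zdGraph d) p with hμ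
  have hsub : boxCrossing d n (3 * n) ⊆ ⋃ q ∈ (Finset.univ : Finset (Fin d × ℤˣ)), thinCrossing n q.1 q.2 := by
    intro ω hω
    obtain ⟨i, hi⟩ := Set.mem_iUnion.1 (boxCrossing_subset_iUnion_thinCrossing hn hω)
    obtain ⟨ε, hε⟩ := Set.mem_iUnion.1 hi
    exact Set.mem_iUnion₂.2 ⟨(i, ε), Finset.mem_univ _, hε⟩
  calc μ.real (boxCrossing d n (3 * n))
      ≤ μ.real (⋃ q ∈ (Finset.univ : Finset (Fin d × ℤˣ)), thinCrossing n q.1 q.2) :=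
        measureReal_mono hsub (measure_ne_top _ _)
    _ ≤ ∑ q ∈ (Finset.univ : Finset (Fin d × ℤˣ)), μ.real (thinCrossing n q.1 q.2) :=
        measureReal_biUnion_finset_le _ _
    _ = ∑ _q ∈ (Finset.univ : Finset (Fin d × ℤˣ)), μ.real (thinCrossing n (0 : Fin d) 1) :=
        Finset.sum_congr rfl fun q _ => real_thinCrossing_eq p n q.1 0 q.2
    _ = 2 * d * μ.real (thinCrossing n (0 : Fin d) 1) := by
        rw [Finset.sum_const, Finset.card_univ, Fintype.card_prod, Fintype.card_fin, Fintype.card_units_int,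
          nsmul_eq_mul]
        push_cast; ring

/-- **The slab-box crossing is a crossing of Kesten's sponge block `(2n, 6n, 6n)`** (`d = 3`, every `p`): the slab-box
`S_{0,+}(n) = [n, 3n] × [-3n, 3n]²` with its two faces is a translate of the block `{0..2n} × {0..6n}²` with its two faces, so
`P_p(thinCrossing n 0 1) ≤ P_p(boxCross (easyShape 3 (2n)) 0)` (`Rsw3.real_linked_le_real_boxCross`). [cite: Kesten1982, §3.3 (3.65)] -/
theorem real_thinCrossing_le_real_boxCross_easyShape (p : unitInterval) (n : ℕ) :
    (bondPercolation (zdGraph 3) p).real (thinCrossing n (0 : Fin 3) 1) ≤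
      (bondPercolation (zdGraph 3) p).real (boxCross (easyShape 3 (2 * n)) 0) := by
  rw [thinCrossing, linked_comm]
  refine real_linked_le_real_boxCross p (v := ![(n : ℤ), -(3 * (n : ℤ)), -(3 * (n : ℤ))])
    (M := ![2 * (n : ℤ), 6 * n, 6 * n]) (L := easyShape 3 (2 * n)) 0 ?_ ?_ ?_ ?_ ?_ ?_ ?_
  · intro x hx j
    obtain ⟨hxbox, hx0⟩ := hx
    rw [mem_box] at hxbox
    fin_cases j
    · have := hxbox 0; simp only [Units.val_one, one_mul] at hx0; simp; omega
    · have := hxbox 1; simp; omega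
    · have := hxbox 2; simp; omega
  · exact fun x hx => hx.1
  · intro x hx
    obtain ⟨-, h⟩ := hx
    simp only [Units.val_one, one_mul] at h
    simp [h]
  · intro x hx
    obtain ⟨-, h⟩ := hx
    simp only [Units.val_one, one_mul] at h
    simp [h]; ring
  · simp [easyShape]
  · simp [easyShape]
  · intro j hj
    fin_cases j
    · exact absurd rfl hj
    · simp [easyShape]; omega
    · simp [easyShape]; omega

/-- **KESTEN'S SPONGE CRITERION, subcritical direction (`ℤ³`, every `p`, `n ≥ 1`):** if the sponge block `{0..2n} × {0..6n}²`
is crossed the SHORT way with probability `< 1/5184 = (2·3)⁻¹·(2·3·12²)⁻¹`, then `p < p_c(ℤ³)`.  Chain: `u_p(n,3n) ≤ 6 σ < 1/864`,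
and `864 · u_p(n, 3n) < 1` is the lane's annulus finite-size criterion at aspect `3`
(`Rsw3.lt_criticalProb_iff_exists_real_boxCrossing_lt`, Kesten 1982 Thm. 5.1 / Hammersley form).
[cite: Kesten1982, Thm. 5.1 and (5.13)] -/
theorem lt_criticalProb_of_real_boxCross_easyShape_three_lt (p : unitInterval) {n : ℕ} (hn : 1 ≤ n)
    (h : (bondPercolation (zdGraph 3) p).real (boxCross (easyShape 3 (2 * n)) 0) < 1 / 5184) :
    (p : ℝ) < criticalProb (zdGraph 3) 0 := by
  rw [lt_criticalProb_iff_exists_real_boxCrossing_lt (d := 3) (by norm_num) p]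
  refine ⟨n, 3 * n, hn, by omega, ?_⟩
  have h1 := real_boxCrossing_three_mul_le_mul_thinCrossing (d := 3) p hn
  have h2 := real_thinCrossing_le_real_boxCross_easyShape p n
  have hn0 : (0 : ℝ) < n := by exact_mod_cast hn
  have hratio : (4 * ((3 * n : ℕ) : ℝ) / n) = 12 := by push_cast; field_simp; ring
  rw [hratio]
  push_cast at h1 ⊢
  nlinarith [h1, h2, h]

/-- **Uniform sponge crossing at and above `p_c(ℤ³)` with an explicit constant:** for every `p ≥ p_c(ℤ³)` and every `n ≥ 1`,
`1/5184 ≤ P_p(boxCross (easyShape 3 (2n)) 0)` — Kesten's `σ((3N,…,N,…,3N); short; p) ≥ κ` for `p ≥ p_S = p_c`, here with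
`κ = 1/5184` (the tree's `Rsw3.easyCrossingLowerBound_three` had `≈ 6·10⁻¹¹`).  Contrapositive of the criterion.
[cite: Kesten1982, Thm. 5.1 and Cor. 5.1] -/
theorem le_real_boxCross_easyShape_three_of_criticalProb_le (p : unitInterval)
    (hp : criticalProb (zdGraph 3) 0 ≤ (p : ℝ)) {n : ℕ} (hn : 1 ≤ n) :
    1 / 5184 ≤ (bondPercolation (zdGraph 3) p).real (boxCross (easyShape 3 (2 * n)) 0) := by
  by_contra h
  push Not at h
  exact absurd (lt_criticalProb_of_real_boxCross_easyShape_three_lt p hn h) (not_lt.2 hp)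

/-- The `p_c` instance: `1/5184 ≤ P_{p_c(ℤ³)}(boxCross (easyShape 3 (2n)) 0)` for all `n ≥ 1`.  builds on p205010 (kernel
theorem, internal audit signed; external expert review pending) — NOT used here: this bound is sharpness-side and unconditional.
[cite: Kesten1982, Thm. 5.1] -/
theorem le_real_boxCross_easyShape_three_criticalProbI {n : ℕ} (hn : 1 ≤ n) :
    1 / 5184 ≤ (bondPercolation (zdGraph 3) (criticalProbI 3)).real (boxCross (easyShape 3 (2 * n)) 0) :=
  le_real_boxCross_easyShape_three_of_criticalProb_le (criticalProbI 3) (by rw [coe_criticalProbI]) hn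

/-- **Sponge crossings vanish below `p_c`** (every `0 ≤ p < p_c(ℤ³)`): `P_p(boxCross (easyShape 3 m) 0) → 0` as `m → ∞`
(`≤ (3m+1)² π_p(m) ≤ 96 m² u_p(1, m) → 0` by sharpness, `Rsw3.tendsto_criterion_of_lt_criticalProb`). [cite: Kesten1982, Cor. 5.1] -/
theorem tendsto_real_boxCross_easyShape_three_of_lt_criticalProb (p : unitInterval)
    (hp : (p : ℝ) < criticalProb (zdGraph 3) 0) :
    Tendsto (fun m : ℕ => (bondPercolation (zdGraph 3) p).real (boxCross (easyShape 3 m) 0)) atTop (𝓝 0) := by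
  have hcrit := tendsto_criterion_of_lt_criticalProb (d := 3) (by norm_num) p hp
  refine squeeze_zero' (Eventually.of_forall fun m => measureReal_nonneg) ?_ hcrit
  rw [eventually_atTop]
  refine ⟨1, fun m hm => ?_⟩
  have hshape : easyShape 3 m = ![(m : ℤ), (3 * m : ℕ), (3 * m : ℕ)] := by
    ext j; fin_cases j <;> simp [easyShape]
  have h1 := real_boxCross_tube_le_sq_mul_oneArmProb p m (3 * m)
  rw [← hshape] at h1
  have h2 : oneArmProb 3 p m ≤ (bondPercolation (zdGraph 3) p).real (boxCrossing 3 1 m) := by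
    rw [← real_boxCrossing_zero_eq_oneArmProb p m]
    exact measureReal_mono (boxCrossing_mono_left (Nat.zero_le 1) m) (measure_ne_top _ _)
  have hm0 : (1 : ℝ) ≤ m := by exact_mod_cast hm
  have h3 : ((3 * m : ℕ) : ℝ) ^ 2 + 2 * ((3 * m : ℕ) : ℝ) + 1 ≤ 2 * (3 : ℕ) * (4 * (m : ℝ) / 1) ^ (3 - 1) := by
    push_cast; nlinarith
  have h4 : 0 ≤ oneArmProb 3 p m := by rw [← real_boxCrossing_zero_eq_oneArmProb p m]; exact measureReal_nonneg
  calc (bondPercolation (zdGraph 3) p).real (boxCross (easyShape 3 m) 0)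
      ≤ (((3 * m : ℕ) : ℝ) + 1) ^ 2 * oneArmProb 3 p m := h1
    _ = (((3 * m : ℕ) : ℝ) ^ 2 + 2 * ((3 * m : ℕ) : ℝ) + 1) * oneArmProb 3 p m := by ring
    _ ≤ 2 * (3 : ℕ) * (4 * (m : ℝ) / 1) ^ (3 - 1) * (bondPercolation (zdGraph 3) p).real (boxCrossing 3 1 m) :=
        mul_le_mul h3 h2 h4 (by positivity)

/-- **`p_S = p_T = p_c` for bond percolation on `ℤ³`, in Kesten's sponge vocabulary (kernel):** for every `p`,
`p < p_c(ℤ³)  ⟺  ∃ n ≥ 1, P_p(boxCross (easyShape 3 (2n)) 0) < 1/5184` — one sponge scale with a small short-way crossing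
probability certifies the subcritical phase (and conversely, below `p_c` every large sponge is crossed with small probability).
Kesten 1982 Thm. 5.1 / Cor. 5.1 (`p_T = p_S`) in the lane's `boxCross` vocabulary, with the explicit threshold `κ = 1/5184`
and even thicknesses (the slab-boxes of `Λ(3n)` have thickness `2n`). [cite: Kesten1982, Thm. 5.1, Cor. 5.1 and (3.65)] -/
theorem lt_criticalProb_iff_exists_real_boxCross_easyShape_three_lt (p : unitInterval) :
    (p : ℝ) < criticalProb (zdGraph 3) 0 ↔
      ∃ n : ℕ, 1 ≤ n ∧ (bondPercolation (zdGraph 3) p).real (boxCross (easyShape 3 (2 * n)) 0) < 1 / 5184 := by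
  constructor
  · intro hp
    have ht := tendsto_real_boxCross_easyShape_three_of_lt_criticalProb p hp
    have hev := (ht.eventually (gt_mem_nhds (by norm_num : (0 : ℝ) < 1 / 5184))).and (eventually_ge_atTop 2)
    -- along even scales
    have hev2 : ∀ᶠ n : ℕ in atTop, (bondPercolation (zdGraph 3) p).real (boxCross (easyShape 3 (2 * n)) 0) < 1 / 5184 := by
      have h2 : Tendsto (fun n : ℕ => 2 * n) atTop atTop := tendsto_id.const_mul_atTop' (by norm_num)
      exact (h2.eventually hev).mono fun n hn => hn.1
    obtain ⟨n, hn⟩ := (hev2.and (eventually_ge_atTop 1)).exists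
    exact ⟨n, hn.2, hn.1⟩
  · rintro ⟨n, hn, h⟩
    exact lt_criticalProb_of_real_boxCross_easyShape_three_lt p hn h

end Rsw3

end Summit.CriticalPhenomena.PercolationContinuityZ3.Theorems

end
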